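import Summits.AtomisticToContinuum.Crystallization.Theses.PalmUnimodularRigidity
import Summits.AtomisticToContinuum.Crystallization.Theorems.MinimiserShells.Negative.LoadBearing
import Summits.AtomisticToContinuum.Crystallization.Theorems.MinimiserShells.Negative.Rootedness
import Literature.Probability.Process.PointStationaryLaw
import Literature.MathematicalPhysics.StatisticalMechanics.RootEnergy
import Literature.MathematicalPhysics.StatisticalMechanics.MuGSC
import Summits.AtomisticToContinuum.Crystallization.Theorems.ChargedEnergyGap.Negative.Unconditional
import Summits.AtomisticToContinuum.Crystallization.Theorems.PalmUnimodularRigidityMinimiserShellsEnergyFloorD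

/-!
# Energy floor `e_uni ≥ e*` (route item 9229 `UnimodularEnergyLowerBound`), part E: the mass
# received at the root (IN side of the mass transport)

Support file for stub `stub_energyFloor` (S2) of line `equilibrium-in-law-surgery` of crux
`MinimiserShells` (stmt-AtomisticToContinuum-9225) = route item stmt-AtomisticToContinuum-9229.

For a rooted `δ`-hard-core configuration `μ = count|S` and a phase `v`, the points of `S` in the
root's cell form a finite CLUSTER `T ∋ 0` (`exists_cluster`).  Seen from a cell-mate `y ∈ T`
(configuration `θ_y μ = μ.map (· - y)`, phase shifted by `-L⁻¹ • y`), the root's cell is the same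
cell and the share sent back to the old root is `(½ ∑_{z ∈ T} V_LJ(‖z - y‖) + C_δ) / #T`
(`share_map_sub_eq`).  Summing over the cluster gives `(𝓔(T) + #T·C_δ)/#T ≥ e* + C_δ` by the
PERIODISATION BOUND `card_mul_eStar_le : #T · e* ≤ 𝓔(T)` (`ChargedEnergyGap.Negative.Unconditional`,
whose `eStar` is the route's `⨅_Q e_LJ(Q)` by `rfl`).  After the phase-average shift lemma of
part A this yields **IN** (`le_lintegral_transport_map`):
`vol([0,1)³) · ofReal (e* + C_δ) ≤ ∫ transport δ L (θ_y μ) (-y) dμ(y)`.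
-/


noncomputable section

open MeasureTheory Filter
open scoped ENNReal BigOperators Topology

namespace Summit.AtomisticToContinuum.Crystallization.Theorems.PalmUnimodularRigidityMinimiserShells.EnergyFloor

open Summit.AtomisticToContinuum.Crystallization.Theorems.MinimiserShells.Negative.Rootedness
  (countable_of_separated)

/-! ## Mass received at the root -/

section Received

open Literature.Probability.Process (IsRootedHardCore count_restrict_singleton_ne_zero_iff
  map_sub_count_restrict)
open Literature.MathematicalPhysics.StatisticalMechanics (lennardJones lennardJones_zero
  interactionEnergy two_mul_interactionEnergy_eq_sum_sum UniformlyDiscrete)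
open Summit.AtomisticToContinuum.Crystallization.Theorems.MinimiserShells.Negative.LoadBearing (eStar)
open Summit.AtomisticToContinuum.Crystallization.Theorems.ChargedEnergyGapNegative (card_mul_eStar_le)

variable {δ L : ℝ}

/-- Local energies of rooted hard-core configurations are `≥ -(250/12) δ⁻⁶ = -C_δ`. -/
theorem locEnergy_add_cst_nonneg (hδ : 0 < δ) {μ : Measure (EuclideanSpace ℝ (Fin 3))}
    (hμ : IsRootedHardCore δ μ) (A : Set (EuclideanSpace ℝ (Fin 3))) :
    0 ≤ locEnergy δ μ A + cst δ := by
  have hmem := mem_hcClass_of_hc hδ hμ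
  have hneg : locNeg δ μ A ≤ ENNReal.ofReal (250 / 6 * δ⁻¹ ^ 6) := by
    unfold locNeg
    rw [trunc_of_mem hmem]
    exact (lintegral_mono fun z => Set.indicator_le_self _ _ z).trans (lintegral_neg_le_of_hc hδ hμ)
  have h1 : (locNeg δ μ A).toReal ≤ 250 / 6 * δ⁻¹ ^ 6 :=
    ENNReal.toReal_le_of_le_ofReal (by positivity) hneg
  have h2 : 0 ≤ (locPos δ μ A).toReal := ENNReal.toReal_nonneg
  unfold locEnergy cst
  linarith

variable {S : Set (EuclideanSpace ℝ (Fin 3))}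

/-- **The cluster**: the points of a separated configuration in the root's cell form a finite set
containing the root. -/
theorem exists_cluster (hδ : 0 < δ) (hL : 0 < L) (h0 : (0 : EuclideanSpace ℝ (Fin 3)) ∈ S)
    (hsep : ∀ x ∈ S, ∀ y ∈ S, x ≠ y → δ ≤ dist x y) (v : EuclideanSpace ℝ (Fin 3)) :
    ∃ T : Finset (EuclideanSpace ℝ (Fin 3)),
      (↑T : Set (EuclideanSpace ℝ (Fin 3))) = rootCell L v ∩ S ∧ (0 : EuclideanSpace ℝ (Fin 3)) ∈ T := by
  have hfin : (rootCell L v ∩ S).Finite :=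
    (UniformlyDiscrete.finite_inter_closedBall ⟨δ, hδ, hsep⟩ 0 (2 * L)).subset fun z hz =>
      ⟨hz.2, rootCell_subset_closedBall hL v hz.1⟩
  refine ⟨hfin.toFinset, hfin.coe_toFinset, ?_⟩
  rw [Set.Finite.mem_toFinset]
  exact ⟨zero_mem_rootCell L v, h0⟩

/-- Sums over the root's cell of `count|S` are finite sums over the cluster. -/
theorem setLIntegral_rootCell_eq_sum {T : Finset (EuclideanSpace ℝ (Fin 3))} {v : EuclideanSpace ℝ (Fin 3)}
    (hT : (↑T : Set (EuclideanSpace ℝ (Fin 3))) = rootCell L v ∩ S) (f : EuclideanSpace ℝ (Fin 3) → ℝ≥0∞) :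
    ∫⁻ y in rootCell L v, f y ∂((Measure.count : Measure (EuclideanSpace ℝ (Fin 3))).restrict S) =
      ∑ y ∈ T, f y := by
  rw [Measure.restrict_restrict (measurableSet_rootCell L v), ← hT, lintegral_finset]
  simp

/-- The mass of the root's cell under `count|S` is the size of the cluster. -/
theorem count_restrict_rootCell_eq_card {T : Finset (EuclideanSpace ℝ (Fin 3))}
    {v : EuclideanSpace ℝ (Fin 3)} (hT : (↑T : Set (EuclideanSpace ℝ (Fin 3))) = rootCell L v ∩ S) :
    (Measure.count : Measure (EuclideanSpace ℝ (Fin 3))).restrict S (rootCell L v) = T.card := by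
  rw [Measure.restrict_apply (measurableSet_rootCell L v), ← hT, Measure.count_apply_finset]

/-- **Re-rooted local sums**: seen from its point `y` (in the root's cell) after the phase shift
`-L⁻¹ • y`, the local sum of `g` is `∑_{z ∈ cluster} g(z - y)`. -/
theorem lintegral_indicator_rootCell_map_sub (hL : L ≠ 0) {T : Finset (EuclideanSpace ℝ (Fin 3))}
    {v y : EuclideanSpace ℝ (Fin 3)} (hT : (↑T : Set (EuclideanSpace ℝ (Fin 3))) = rootCell L v ∩ S)
    (hy : y ∈ rootCell L v) {g : EuclideanSpace ℝ (Fin 3) → ℝ≥0∞} (hg : Measurable g) :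
    ∫⁻ z, (rootCell L (v - L⁻¹ • y)).indicator g z
        ∂(((Measure.count : Measure (EuclideanSpace ℝ (Fin 3))).restrict S).map fun z => z - y) =
      ∑ z ∈ T, g (z - y) := by
  rw [lintegral_map (hg.indicator (measurableSet_rootCell L _)) (measurable_sub_const y)]
  have hpt : ∀ z : EuclideanSpace ℝ (Fin 3), (rootCell L (v - L⁻¹ • y)).indicator g (z - y) =
      (rootCell L v).indicator (fun z => g (z - y)) z := by
    intro z
    rw [← preimage_sub_rootCell hL hy]
    exact (Set.indicator_comp_right (fun z : EuclideanSpace ℝ (Fin 3) => z - y)).symm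
  simp_rw [hpt]
  rw [lintegral_indicator (measurableSet_rootCell L v), setLIntegral_rootCell_eq_sum hT]

/-- **The share received from a cell-mate.** For a rooted hard-core configuration `count|S`, a phase
`v` with cluster `T`, and a point `y ∈ T`: in the configuration re-rooted at `y`, at the shifted
phase, the share sent to the old root is `(½ ∑_{z ∈ T} V_LJ(‖z - y‖) + C_δ) / #T`. -/
theorem share_map_sub_eq (hδ : 0 < δ) (hL : 0 < L) (h0 : (0 : EuclideanSpace ℝ (Fin 3)) ∈ S)
    (hsep : ∀ x ∈ S, ∀ y ∈ S, x ≠ y → δ ≤ dist x y) {T : Finset (EuclideanSpace ℝ (Fin 3))}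
    {v y : EuclideanSpace ℝ (Fin 3)} (hT : (↑T : Set (EuclideanSpace ℝ (Fin 3))) = rootCell L v ∩ S)
    (hy : y ∈ T) :
    locEnergy δ (((Measure.count : Measure (EuclideanSpace ℝ (Fin 3))).restrict S).map fun z => z - y)
        (rootCell L (v - L⁻¹ • y)) = (∑ z ∈ T, lennardJones ‖z - y‖) / 2 ∧
      share δ (((Measure.count : Measure (EuclideanSpace ℝ (Fin 3))).restrict S).map fun z => z - y)
        (rootCell L (v - L⁻¹ • y)) =
        ENNReal.ofReal ((∑ z ∈ T, lennardJones ‖z - y‖) / 2 + cst δ) / T.card := by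
  have hyS : y ∈ rootCell L v ∩ S := by rw [← hT]; exact hy
  have hμ : IsRootedHardCore δ ((Measure.count : Measure (EuclideanSpace ℝ (Fin 3))).restrict S) :=
    ⟨S, h0, hsep, rfl⟩
  have hν : IsRootedHardCore δ
      (((Measure.count : Measure (EuclideanSpace ℝ (Fin 3))).restrict S).map fun z => z - y) :=
    hμ.map_sub ((count_restrict_singleton_ne_zero_iff S y).2 hyS.2)
  have hmem := mem_hcClass_of_hc hδ hν
  have hL0 : L ≠ 0 := hL.ne'
  -- the local sums
  have hpos : locPos δ (((Measure.count : Measure (EuclideanSpace ℝ (Fin 3))).restrict S).map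
      fun z => z - y) (rootCell L (v - L⁻¹ • y)) = ∑ z ∈ T, ENNReal.ofReal (lennardJones ‖z - y‖) := by
    unfold locPos
    rw [trunc_of_mem hmem]
    exact lintegral_indicator_rootCell_map_sub hL0 hT hyS.1 measurable_ofReal_lennardJones_norm
  have hneg : locNeg δ (((Measure.count : Measure (EuclideanSpace ℝ (Fin 3))).restrict S).map
      fun z => z - y) (rootCell L (v - L⁻¹ • y)) = ∑ z ∈ T, ENNReal.ofReal (-lennardJones ‖z - y‖) := by
    unfold locNeg
    rw [trunc_of_mem hmem]
    exact lintegral_indicator_rootCell_map_sub hL0 hT hyS.1 measurable_ofReal_neg_lennardJones_norm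
  have hloc : locEnergy δ (((Measure.count : Measure (EuclideanSpace ℝ (Fin 3))).restrict S).map
      fun z => z - y) (rootCell L (v - L⁻¹ • y)) = (∑ z ∈ T, lennardJones ‖z - y‖) / 2 := by
    unfold locEnergy
    rw [hpos, hneg, ENNReal.toReal_sum fun _ _ => ENNReal.ofReal_ne_top,
      ENNReal.toReal_sum fun _ _ => ENNReal.ofReal_ne_top, ← Finset.sum_sub_distrib]
    congr 1
    refine Finset.sum_congr rfl fun z _ => ?_
    rw [ENNReal.toReal_ofReal', ENNReal.toReal_ofReal']
    exact max_zero_sub_max_neg_zero_eq_self _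
  refine ⟨hloc, ?_⟩
  -- the count
  have hcount : trunc δ (((Measure.count : Measure (EuclideanSpace ℝ (Fin 3))).restrict S).map
      fun z => z - y) (rootCell L (v - L⁻¹ • y)) = T.card := by
    rw [trunc_of_mem hmem, Measure.map_apply (measurable_sub_const y) (measurableSet_rootCell L _),
      preimage_sub_rootCell hL0 hyS.1, count_restrict_rootCell_eq_card hT]
  unfold share
  rw [hloc, hcount]

/-- **Cluster energy = interaction energy**: `∑_{y ∈ T} ½ ∑_{z ∈ T} V_LJ(‖z - y‖) = 𝓔(x)` for any
enumeration `x` of the cluster (`V_LJ(0) = 0` takes care of the diagonal). -/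
theorem sum_half_sum_eq_interactionEnergy (T : Finset (EuclideanSpace ℝ (Fin 3))) :
    ∑ y ∈ T, (∑ z ∈ T, lennardJones ‖z - y‖) / 2 =
      interactionEnergy lennardJones (fun i : Fin T.card => ((T.equivFin.symm i : T) : EuclideanSpace ℝ (Fin 3))) := by
  set x : Fin T.card → EuclideanSpace ℝ (Fin 3) := fun i => ((T.equivFin.symm i : T) : EuclideanSpace ℝ (Fin 3))
  have h2 := two_mul_interactionEnergy_eq_sum_sum lennardJones lennardJones_zero x
  have hre : ∀ f : EuclideanSpace ℝ (Fin 3) → ℝ, ∑ y ∈ T, f y = ∑ i : Fin T.card, f (x i) := by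
    intro f
    rw [← Finset.sum_coe_sort T f]
    exact (Equiv.sum_comp T.equivFin.symm (fun y : T => f y)).symm
  rw [← Finset.sum_div, hre]
  simp_rw [hre]
  have hd : ∀ i k : Fin T.card, lennardJones ‖x k - x i‖ = lennardJones (dist (x i) (x k)) := by
    intro i k; rw [dist_eq_norm, norm_sub_rev]
  simp_rw [hd]
  linarith

/-- The enumeration of a finset is injective. -/
theorem injective_enum (T : Finset (EuclideanSpace ℝ (Fin 3))) :
    Function.Injective (fun i : Fin T.card => ((T.equivFin.symm i : T) : EuclideanSpace ℝ (Fin 3))) :=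
  Subtype.val_injective.comp T.equivFin.symm.injective

/-- **Periodisation at the root's cell**: `#T · (e* + C_δ) ≤ ∑_{y ∈ T} (½ ∑_{z ∈ T} V(‖z-y‖) + C_δ)`. -/
theorem card_mul_le_sum_cluster (δ : ℝ) (T : Finset (EuclideanSpace ℝ (Fin 3))) :
    (T.card : ℝ) * (eStar + cst δ) ≤ ∑ y ∈ T, ((∑ z ∈ T, lennardJones ‖z - y‖) / 2 + cst δ) := by
  rw [Finset.sum_add_distrib, sum_half_sum_eq_interactionEnergy, Finset.sum_const, nsmul_eq_mul]
  have h := card_mul_eStar_le (injective_enum T)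
  change (T.card : ℝ) * eStar ≤ _ at h
  linarith

/-- **Mass received at the root at a fixed phase**: at least `e* + C_δ`. -/
theorem ofReal_le_lintegral_received (hδ : 0 < δ) (hL : 0 < L) (h0 : (0 : EuclideanSpace ℝ (Fin 3)) ∈ S)
    (hsep : ∀ x ∈ S, ∀ y ∈ S, x ≠ y → δ ≤ dist x y) (v : EuclideanSpace ℝ (Fin 3)) :
    ENNReal.ofReal (eStar + cst δ) ≤
      ∫⁻ y, (rootCell L (v - L⁻¹ • y)).indicator
        (fun _ => share δ (((Measure.count : Measure (EuclideanSpace ℝ (Fin 3))).restrict S).map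
          fun z => z - y) (rootCell L (v - L⁻¹ • y))) (-y)
        ∂((Measure.count : Measure (EuclideanSpace ℝ (Fin 3))).restrict S) := by
  obtain ⟨T, hT, h0T⟩ := exists_cluster hδ hL h0 hsep v
  have hL0 : L ≠ 0 := hL.ne'
  -- the integrand is supported on the root's cell
  have hpt : ∀ y : EuclideanSpace ℝ (Fin 3), (rootCell L (v - L⁻¹ • y)).indicator
      (fun _ => share δ (((Measure.count : Measure (EuclideanSpace ℝ (Fin 3))).restrict S).map
        fun z => z - y) (rootCell L (v - L⁻¹ • y))) (-y) =
      (rootCell L v).indicator (fun y => share δ (((Measure.count : Measure (EuclideanSpace ℝ (Fin 3))).restrict S).map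
        fun z => z - y) (rootCell L (v - L⁻¹ • y))) y := by
    intro y
    by_cases hy : y ∈ rootCell L v
    · rw [Set.indicator_of_mem ((neg_mem_rootCell_iff hL0 v y).2 hy), Set.indicator_of_mem hy]
    · rw [Set.indicator_of_notMem (fun h => hy ((neg_mem_rootCell_iff hL0 v y).1 h)),
        Set.indicator_of_notMem hy]
  simp_rw [hpt]
  rw [lintegral_indicator (measurableSet_rootCell L v), setLIntegral_rootCell_eq_sum hT]
  -- evaluate the shares
  rw [Finset.sum_congr rfl fun y hy => (share_map_sub_eq hδ hL h0 hsep hT hy).2]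
  have hcard0 : (T.card : ℝ≥0∞) ≠ 0 := by
    exact_mod_cast (Finset.card_pos.2 ⟨0, h0T⟩).ne'
  have hcardtop : (T.card : ℝ≥0∞) ≠ ∞ := ENNReal.natCast_ne_top _
  have hnonneg : ∀ y ∈ T, 0 ≤ (∑ z ∈ T, lennardJones ‖z - y‖) / 2 + cst δ := by
    intro y hy
    rw [← (share_map_sub_eq hδ hL h0 hsep hT hy).1]
    refine locEnergy_add_cst_nonneg hδ ?_ _
    have hyS : y ∈ rootCell L v ∩ S := by rw [← hT]; exact hy
    exact (show IsRootedHardCore δ ((Measure.count : Measure (EuclideanSpace ℝ (Fin 3))).restrict S)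
      from ⟨S, h0, hsep, rfl⟩).map_sub ((count_restrict_singleton_ne_zero_iff S y).2 hyS.2)
  simp_rw [ENNReal.div_eq_inv_mul]
  rw [← Finset.mul_sum, ← ENNReal.ofReal_sum_of_nonneg hnonneg, ← ENNReal.div_eq_inv_mul]
  rw [ENNReal.le_div_iff_mul_le (Or.inl hcard0) (Or.inl hcardtop)]
  calc ENNReal.ofReal (eStar + cst δ) * T.card
      = ENNReal.ofReal ((T.card : ℝ) * (eStar + cst δ)) := by
        rw [ENNReal.ofReal_mul (Nat.cast_nonneg _), ENNReal.ofReal_natCast, mul_comm]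
    _ ≤ ENNReal.ofReal (∑ y ∈ T, ((∑ z ∈ T, lennardJones ‖z - y‖) / 2 + cst δ)) :=
        ENNReal.ofReal_le_ofReal (card_mul_le_sum_cluster δ T)

/-- **IN**: the total mass received at the root of a rooted hard-core configuration is at least
`vol([0,1)³) · (e* + C_δ)`. -/
theorem le_lintegral_transport_map (hδ : 0 < δ) (hL : 0 < L) {μ : Measure (EuclideanSpace ℝ (Fin 3))}
    (hμ : IsRootedHardCore δ μ) :
    volume phaseDom * ENNReal.ofReal (eStar + cst δ) ≤
      ∫⁻ y, transport δ L (μ.map fun z => z - y) (-y) ∂μ := by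
  obtain ⟨S, h0, hsep, rfl⟩ := hμ
  have hS := countable_of_separated hδ hsep
  have hL0 : L ≠ 0 := hL.ne'
  -- Step 1: phase shift inside the transport
  have hshift : ∀ y : EuclideanSpace ℝ (Fin 3), ∀ ν : Measure (EuclideanSpace ℝ (Fin 3)),
      transport δ L ν (-y) = ∫⁻ v in phaseDom, (rootCell L (v - L⁻¹ • y)).indicator
        (fun _ => share δ ν (rootCell L (v - L⁻¹ • y))) (-y) := by
    intro y ν
    unfold transport
    exact (setLIntegral_phaseDom_sub (measurable_transport_integrand_phase δ L ν (-y))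
      (fun k hk w => by simp only [rootCell_int_add hk]) (L⁻¹ • y)).symm
  simp_rw [hshift]
  -- Step 2: swap
  rw [lintegral_count_restrict_setLIntegral_comm hS
    (F := fun y v => (rootCell L (v - L⁻¹ • y)).indicator (fun _ => share δ
      (((Measure.count : Measure (EuclideanSpace ℝ (Fin 3))).restrict S).map fun z => z - y)
      (rootCell L (v - L⁻¹ • y))) (-y))
    (fun y => (measurable_transport_integrand_phase δ L _ (-y)).comp (measurable_sub_const _))
    phaseDom]
  -- Step 3: pointwise bound
  calc volume phaseDom * ENNReal.ofReal (eStar + cst δ)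
      = ∫⁻ _ in phaseDom, ENNReal.ofReal (eStar + cst δ) := by
        rw [setLIntegral_const, mul_comm]
    _ ≤ _ := lintegral_mono fun v => ofReal_le_lintegral_received hδ hL h0 hsep v

end Received

end Summit.AtomisticToContinuum.Crystallization.Theorems.PalmUnimodularRigidityMinimiserShells.EnergyFloor

end
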